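import Literature.NumberTheory.Automorphic.ClozelAlgebraicityHeckeFieldProofs
import Literature.NumberTheory.Automorphic.ClozelCohomologicalTypeProofs
import Literature.NumberTheory.Automorphic.CuspidalCohomologyGL
import Literature.NumberTheory.Automorphic.AutomorphicRepsGLSatakeProofs
import Literature.NumberTheory.Automorphic.UnramifiedHeckeLevel
import HarnessLib

/-!
# Clozel's Hecke-field theorem over `ℚ`: reduction to the tree's cohomology of `GL_n/ℚ` (proofs)

Proofs-only companion (theorems only: no definition, no named fact, no instance) of
`ClozelAlgebraicity.lean` / `ClozelAlgebraicityHeckeFieldProofs.lean`, for the `K = ℚ` slice of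
the named fact `Clozel1990_heckeEigenvalueField` (Clozel 1990, Thm. 3.13: the unramified Hecke
eigenvalues `t_{v,i}` of a cuspidal regular algebraic `π` on `GL_n(𝔸_K)` lie, for almost all `v`,
in one number field).

Clozel's proof (§3.5; Grobner–Raghuram 2014, §7–§8) realises `π_f` in the Betti cohomology of the
adelic locally symmetric spaces with coefficients in the algebraic local system `ℰ_μ` and reads the
rationality off the `ℚ(μ)`-structure of that cohomology. Over `K = ℚ` the tree HAS the receptacle:
`GLnCohomology.levelCohomology k n N λ q = H^q(GL_n(ℚ)⁺, Fun(GL_n(𝔸^∞)/K_f(N), V_λ(k)))` with its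
unramified Hecke operators `GLnCohomology.heckeT` and the interior part `CuspidalCohomologyGL n N λ`
(`CuspidalCohomologyGL.lean`), and the realisation step is the named fact
`GLnCohomology.cuspidalEigenclass_exists` (Eichler–Shimura / Borel / Franke: a cuspidal `π` of
cohomological infinity type `λ^∨ + ρ` with a `K(N)`-fixed vector has a non-zero simultaneous
eigenclass in `H^{b_n}_!(S(K_f(N)), Ṽ_λ ⊗ ℂ)` with the Satake–Tamagawa eigenvalues). This file
proves:

* `Clozel1990_heckeEigenvalueField.rat_of_cuspidalEigenclass_exists` — **the `K = ℚ` slice of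
  `Clozel1990_heckeEigenvalueField` follows from `cuspidalEigenclass_exists` together with the
  Betti rationality of `levelCohomology ℂ` in SEMILINEAR form**: finite-dimensionality of
  `H = levelCohomology ℂ n N λ b_n` (Borel–Serre / Raghunathan finiteness through Shapiro's lemma:
  the tree's fact `BorelSerre1973_finiteDimensional_groupCohomology` and route item
  `InteriorCohomologyFiniteDim`) and, for every `σ ∈ Aut(ℂ)`, an injective `σ`-semilinear
  `θ_σ : H → H` commuting with the `T_{v,i}` (in print `σ^*` on `H^•(S, Ṽ_λ ⊗_{ℚ,σ} ℂ) =
  H^•(S, Ṽ_λ ⊗ ℂ)`, i.e. `H = levelCohomology ℚ ⊗_ℚ ℂ` Hecke-equivariantly — Clozel 1990, p. 122;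
  Grobner–Raghuram 2014, Lemma 37–38), both taken as hypotheses on the tree's carrier.
  Assembly: a regular algebraic `π` has a cohomological infinity type
  (`AutomorphicRepData.IsRegularAlgebraic.exists_hasInfinityType_cohomological`, Clozel Lemme 3.14
  on multisets, `ClozelCohomologicalTypeProofs`); every automorphic `π` has a `K(𝔫)`-fixed vector
  off `W'` (`AutomorphicRepData.exists_principalCongruenceLevel_fixed`), hence a `K(N)`-fixed one for
  `N = Nm(𝔫)` (`principalCongruenceLevel_mono`); `cuspidalEigenclass_exists` gives the eigenclass
  `x ≠ 0` with `T_{v,i} x = t_{v,i} x` for `v ∤ N`; and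
  `heckeEigenvalue_mem_subfield_cofinite_of_semilinearAction` (step 4(b) of the printed proof,
  `ClozelAlgebraicityHeckeFieldProofs`) concludes. (`n = 0`:
  `Clozel1990_heckeEigenvalueField.rank_zero`.)

Nothing here is asserted: the two cohomological inputs are explicit hypotheses, so the theorem
records exactly what separates the `ℚ`-case of the fact from the tree.

## References

* L. Clozel, *Motifs et formes automorphes: applications du principe de fonctorialité* (1990),
  Lemme 3.14, Thm. 3.13 and its proof, §3.5 pp. 122–123. [Clozel1990]
* H. Grobner, A. Raghuram, *On some arithmetic properties of automorphic forms of GL_m over a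
  division algebra*, Int. J. Number Theory 10 (2014) = arXiv:1102.1872, Lemma 37, Lemma 38,
  Prop. 41, Thm. 50 (arXiv numbering). [GrobnerRaghuram2014]
-/

noncomputable section

open scoped Classical
open NumberField IsDedekindDomain IntermediateField

namespace Literature.NumberTheory.Automorphic

open Literature.NumberTheory.DiophantineGeometry Literature.Barriers.Langlands

/-- **The `K = ℚ` slice of `Clozel1990_heckeEigenvalueField`, from the cuspidal eigenclass and the
Betti rationality of the tree's cohomology of `GL_n/ℚ` (semilinear form).** Assume
(1) `GLnCohomology.cuspidalEigenclass_exists` (Eichler–Shimura / Borel / Franke realisation), and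
(2) for all `n, N ≥ 1` and dominant `λ`: `H = levelCohomology ℂ n N λ b_n` is finite-dimensional and
carries, for every `σ ∈ Aut(ℂ)`, an injective `σ`-semilinear map commuting with every `T_{v,i}`
(`σ^*` of the `ℚ`-structure `H = H_ℚ ⊗ ℂ`; Clozel 1990, p. 122; Grobner–Raghuram 2014, Lemma 38).
Then for every cuspidal regular algebraic `π` on `GL_n(𝔸_ℚ)` the unramified Hecke eigenvalues
`t_{v,i}`, at all but finitely many `v`, lie in one subfield of `ℂ` finite over `ℚ` — the
conclusion of `Clozel1990_heckeEigenvalueField` at `K = ℚ`. Proof: Lemme 3.14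
(`exists_hasInfinityType_cohomological`) + a `K(N)`-fixed vector
(`exists_principalCongruenceLevel_fixed`, `N = Nm 𝔫`, `principalCongruenceLevel_mono`) feed (1);
the eigenclass and (2) feed `heckeEigenvalue_mem_subfield_cofinite_of_semilinearAction` with the
finite exceptional set `{v ∣ N}`. [cite: Clozel1990, Thm. 3.13 (proof, §3.5)]
[cite: GrobnerRaghuram2014, Thm. 50 (arXiv:1102.1872 numbering)] -/
theorem Clozel1990_heckeEigenvalueField.rat_of_cuspidalEigenclass_exists
    (hE : GLnCohomology.cuspidalEigenclass_exists)
    (hB : ∀ (n N : ℕ) (wt : Fin n → ℤ), 1 ≤ n → 1 ≤ N → Weight.IsDominant wt →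
      FiniteDimensional ℂ (GLnCohomology.levelCohomology ℂ n N wt (GLnCohomology.bottomDegree n)) ∧
      ∃ θ : ∀ σ : ℂ ≃ₐ[ℚ] ℂ, GLnCohomology.levelCohomology ℂ n N wt (GLnCohomology.bottomDegree n) →ₛₗ[(σ : ℂ →+* ℂ)]
          GLnCohomology.levelCohomology ℂ n N wt (GLnCohomology.bottomDegree n),
        (∀ (σ : ℂ ≃ₐ[ℚ] ℂ) (v : HeightOneSpectrum (𝓞 ℚ)) (i : ℕ)
            (z : GLnCohomology.levelCohomology ℂ n N wt (GLnCohomology.bottomDegree n)),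
          θ σ (GLnCohomology.heckeT ℂ n N wt (GLnCohomology.bottomDegree n) v i z) =
            GLnCohomology.heckeT ℂ n N wt (GLnCohomology.bottomDegree n) v i (θ σ z)) ∧
        ∀ σ : ℂ ≃ₐ[ℚ] ℂ, Function.Injective (θ σ))
    (n : ℕ) (hcpt : isCompact_glFiniteIntegralLevel n ℚ) (π : CuspidalAutomorphicRepData n ℚ hcpt)
    (hπ : π.1.IsRegularAlgebraic) :
    ∃ E : Subfield ℂ, FiniteDimensional ℚ E ∧
      ∀ᶠ v : HeightOneSpectrum (𝓞 ℚ) in Filter.cofinite, ∀ α : Multiset ℂ,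
        π.1.HasSatakeParamAt v α → ∀ i ≤ n, heckeEigenvalueOf n v α i ∈ E := by
  -- `n = 0` is the degenerate slice
  rcases Nat.eq_zero_or_pos n with rfl | hn
  · exact Clozel1990_heckeEigenvalueField.rank_zero ℚ hcpt π
  -- Lemme 3.14: a cohomological infinity type `λ^∨ + ρ`, `λ = wt` dominant
  obtain ⟨wt, hdom, hT⟩ := hπ.exists_hasInfinityType_cohomological
  -- a `K(𝔫)`-fixed vector off `W'`, hence a `K(N)`-fixed one for `N = Nm 𝔫`
  obtain ⟨𝔫, h𝔫, φ, hφW, hφW', hfix⟩ := π.1.exists_principalCongruenceLevel_fixed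
  set N : ℕ := Ideal.absNorm 𝔫 with hNdef
  have hN0 : N ≠ 0 := fun h0 ↦ h𝔫 (Ideal.absNorm_eq_zero_iff.mp h0)
  have hN : 1 ≤ N := Nat.one_le_iff_ne_zero.mpr hN0
  have hspan_le : Ideal.span {(N : 𝓞 ℚ)} ≤ 𝔫 :=
    (Ideal.span_singleton_le_iff_mem _).mpr (Ideal.absNorm_mem 𝔫)
  have hspan0 : Ideal.span {(N : 𝓞 ℚ)} ≠ 0 := by
    rw [Ne, Ideal.zero_eq_bot, Ideal.span_singleton_eq_bot]
    exact_mod_cast hN0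
  have hfixN : ∀ u ∈ principalCongruenceLevel n ℚ (Ideal.span {(N : 𝓞 ℚ)}),
      rightTranslation (AdelicGroupData.gl n ℚ) u φ = φ :=
    fun u hu ↦ hfix u (principalCongruenceLevel_mono n ℚ hspan0 hspan_le hu)
  -- the cuspidal eigenclass
  obtain ⟨x, -, hx, heig⟩ := hE n N hn hN hcpt wt hdom π hT ⟨φ, hφW, hφW', hfixN⟩
  -- the Betti rationality in semilinear form, restricted to `Aut(ℂ/ℚ) = Aut(ℂ)`
  obtain ⟨hfd, θ, hθS, hθinj⟩ := hB n N wt hn hN hdom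
  haveI := hfd
  let θ' : ∀ σ : (⊥ : IntermediateField ℚ ℂ).fixingSubgroup,
      GLnCohomology.levelCohomology ℂ n N wt (GLnCohomology.bottomDegree n) →ₛₗ[((σ : ℂ ≃ₐ[ℚ] ℂ) : ℂ →+* ℂ)]
        GLnCohomology.levelCohomology ℂ n N wt (GLnCohomology.bottomDegree n) := fun σ ↦ θ σ
  -- the finite exceptional set `{v ∣ N}`
  have hS : {v : HeightOneSpectrum (𝓞 ℚ) | v.asIdeal ∣ Ideal.span {(N : 𝓞 ℚ)}}.Finite :=
    Ideal.finite_factors hspan0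
  exact heckeEigenvalue_mem_subfield_cofinite_of_semilinearAction π.1 ⊥ hS
    (fun v i ↦ GLnCohomology.heckeT ℂ n N wt (GLnCohomology.bottomDegree n) v i) θ' (fun σ v i z ↦ hθS σ v i z)
    (fun σ ↦ hθinj σ) hx (fun v hv α hα i hi ↦ heig v hv α hα i hi)

end Literature.NumberTheory.Automorphic

end
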